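import Literature.AnabelianGeometry.EtaleTheta.Discharge.Sec2MonoThetaAutLift
import Literature.AnabelianGeometry.EtaleTheta.Discharge.Sec2Prop214iiOfSetting
import Literature.AnabelianGeometry.EtaleTheta.TemperedRigidity
import Literature.IUT.HodgeArakelov.CohomologyAutFunctoriality

/-!
# [EtTh] Prop 2.14 (iii), the `{±1}`-part AT THE §1 MODEL: an inversion `ι` of `Π^tp_X` lifts to an
# automorphism of the model mono-theta environment `M(η)` (proof-only companion)

Mochizuki, *The Étale Theta Function and its Frobenioid-theoretic Manifestations* [EtTh], Publ. RIMS 45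
(2009), §2, Prop 2.14 (iii) pp.49–50 (locators `p.N` = PDF pages of the PRIMS text; bib key
`MochizukiEtTh2009`): "every automorphism of `M` … induces an automorphism `∈ (l·ℤ) ⋊ {±1}` of `ℤ`.
Moreover, the resulting homomorphism `Aut(M) → (l·ℤ) ⋊ {±1}` is surjective". PROOF-ONLY companion (no
`def`; seat abc-iut-L2-t2, §2 owner) of `ThetaRigidity.lean` (`RigidData.Prop214_iii_mono`) at
abc-iut-L2-t8's §1 instantiation `C.rigidData` (`RigidOfSetting.lean`), continuing
`Discharge/Sec2MonoThetaAutLift.lean` (the per-automorphism lift) and abc-iut-L2-t2 g3's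
`Discharge/Sec2Prop214iiiMonoTranslations.lean` (the `l·ℤ`-part: every `Gal(Y/X)`-translation lifts).

THE `{±1}`-PART. The inversion of `X` is not an element of `Π^tp_X` but an automorphism `ι` of it
(conjugation by an element of `Π^tp_C ∖ Π^tp_X`, `C = X/{±1}`, Def 2.1 p.36). In the §1 typing
(abc-iut-L2-t1) such an automorphism with its companion on the theta quotient is the pair
`(ι, c : ThetaCompanion ι)` of `TemperedRigidity.lean` (Thm 1.6 (ii)), `Thm16i ι` = "`ι(Π^tp_Ÿ) = Π^tp_Ÿ`",
and "the isomorphism of cohomology groups induced by `ι`" is `transport c h` (Thm 1.6 (iii)); its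
restriction to `Π^tp_X̲̲ = C.Huu` is any `φ : Π^tp_X̲̲ ≃ₜ* Π^tp_X̲̲` agreeing with `ι` (abc-iut-w5-d072's
`EtaleThetaDataOfSetting.inversionAlpha C ι hι` is one, by its `coe_inversionAlpha`).

* `transport_eq_autMap` — abc-iut-L2-t1's `transport c h` IS abc-iut-L6-t1's `ContH1Aut.autMap` for the
  pair `(ι, c.thetaIso)` (definitional bookkeeping, so both lineages' binders interchange).
* `autCocycle_mem_rootCocycles` — if `ι(Π^tp_X̲̲) = Π^tp_X̲̲` (Def 2.5 (i)) and **`ι` carries the étale theta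
  class `η̈^Θ ∈ H¹(Π^tp_Ÿ, Δ_Θ)` to a `Π^tp_X̲̲`-conjugate** (`hιη`; print: Prop 1.4 (ii) "`Θ̈(Ü⁻¹) = −Θ̈(Ü)`",
  "`Θ̈(−Ü) = −Θ̈(Ü)`", p.22 — the pull-back of `Θ̈` by the inversion is `−Θ̈`, i.e. the `Gal(Ÿ/Y)`-conjugate
  of `Θ̈`, so `ι_* η̈^Θ = τ · η̈^Θ` for `τ ∈ Π^tp_Y̲̲ ∖ Π^tp_Ÿ̲̲`, or `= η̈^Θ` for the other lift), then the
  transport `c.thetaIso ∘ f ∘ ι⁻¹` of every cocycle of the collection `η̲̈^{Θ,l·ℤ×μ₂}` (abc-iut-L2-t8's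
  `rootCocycles`: `l·Δ_Θ`-valued lifts of the `Π^tp_X̲̲`-conjugates of `η̈^Θ|_{Π^tp_Ÿ̲̲}`) is again in the
  collection (functoriality `res_autMap`, equivariance `autMap_conj` of abc-iut-L6-t1).
* `comp_symm_mem_thetaCocycles` — hence, when `ι` acts by `+1` on `Δ_Θ` (Prop 2.2 (i), p.37: "acts on
  [`Δ̄_Θ`] by `+1`"), the mod-`N` theta cocycles `C.thetaCocycles hC μ` are stable under `η ↦ η ∘ ι⁻¹`.
* **`rigidData_exists_monoIso_over_inversion`** — for `R = C.rigidData μ hC hS h15 L`: an inversion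
  datum `(ι, c)` with `Thm16i ι`, `ι(Π^tp_X̲̲) = Π^tp_X̲̲`, `ι(Π^tp_Y) = Π^tp_Y`, `ι(Δ^tp_X) = Δ^tp_X`, `+1` on
  `Δ_Θ` and `hιη` LIFTS: for every theta cocycle `η` there is `α ∈ Aut(M(η))` inducing `ι` on `Π^tp_Y̲̲` —
  by `RigidData.exists_monoIso_over_aut_of_comp_symm_mem` with Cor 2.18 (ii) BY NAME; and
  `…_tower` with Cor 2.18 (ii) supplied by abc-iut-L2-t10's theorem `rigidData_cor218_ii` (conditional on
  Prop 1.5 (ii), (iii) only). This is the EXISTENCE content of the `{±1}`-factor of Prop 2.14 (iii); the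
  LABEL bookkeeping "`ι` acts on the cusp labels `ℤ` by `−1`" (`RigidData.ActsOnCuspsBy _ _ (-1)`) is not
  derivable at the model, where the labels `C.CuspLabels` are free input data (no equivariance clause).

RESIDUAL (honest): `hιη` is a HYPOTHESIS on the abstract class `E.etaDd` (no carrier for `Θ̈` as a
function under an OUTER automorphism in the §1 typing; the deck-transformation half "`Θ̈(−Ü) = −Θ̈(Ü)`"
is abc-iut-w5-d125's `conj_etaDd_eq_mul_kumYdd_neg_one`, `ThetaKummerDeck.lean`). HONEST FRAMING: [EtTh]
is refereed; OUR kernel checks at the cell's §1 model; no side is taken on [IUTchIII] Cor 3.12; typed ≠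
discharged elsewhere.
-/

noncomputable section

namespace Literature.AnabelianGeometry.EtaleTheta

open Literature.IUT.HodgeArakelov

namespace ThetaSetting

variable {p : ℕ} [Fact p.Prime] {D : ThetaSetting p}

/-! ## The inversion datum `(ι, c)` of §1 and the two transports -/

section InversionDatum

variable (ι : D.PiTemp ≃ₜ* D.PiTemp)

/-- `γ^Θ ∘ (·)^Θ = (·)^Θ ∘ γ` in abc-iut-L6-t1's argument order. [cite: MochizukiEtTh2009, Thm 1.6 (ii) p.24] -/
theorem ThetaCompanion.comm' (c : ThetaCompanion ι) (g : D.PiTemp) : c.thetaIso (D.toTheta g) = D.toTheta (ι g) :=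
  (c.comm g).symm

/-- A theta companion maps `Δ_Θ` into `Δ_Θ` (membership form). [cite: MochizukiEtTh2009, Thm 1.6 (ii) p.24] -/
theorem ThetaCompanion.apply_mem' (c : ThetaCompanion ι) (a : D.GtpTheta) (ha : a ∈ D.DeltaTheta) : c.thetaIso a ∈ D.DeltaTheta :=
  c.apply_mem ⟨a, ha⟩

/-- A theta companion maps `Δ_Θ` ONTO `Δ_Θ`, hence `l·Δ_Θ` onto `l·Δ_Θ`: membership in `l·Δ_Θ` is
`γ^Θ`-invariant (abc-iut-w5-d072's `mem_lDeltaTheta_iff_thetaCompanion`, restated here to keep the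
imports inside L2). [cite: MochizukiEtTh2009, Prop 2.12 (i) p.45] -/
theorem ThetaCompanion.mem_lDeltaTheta_iff (c : ThetaCompanion ι) (n : ℕ) (a : D.GtpTheta) :
    a ∈ D.lDeltaTheta n ↔ c.thetaIso a ∈ D.lDeltaTheta n := by
  constructor
  · rintro ⟨y, hy, rfl⟩
    exact ⟨c.thetaIso y, c.apply_mem ⟨y, hy⟩, by rw [map_pow]⟩
  · rintro ⟨y, hy, hya⟩
    have hy' : y ∈ D.DeltaTheta.map c.thetaIso.toMulEquiv.toMonoidHom := by rw [c.map_deltaTheta]; exact hy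
    obtain ⟨y', hy'mem, hy'eq⟩ := hy'
    refine ⟨y', hy'mem, c.thetaIso.injective ?_⟩
    rw [map_pow, ← hya, ← hy'eq]
    rfl

/-- `Ker((·)^Θ)` is `ι`-invariant. [cite: MochizukiEtTh2009, Cor 2.18 (i) p.60] -/
theorem ThetaCompanion.toTheta_eq_one_iff (c : ThetaCompanion ι) (x : D.PiTemp) :
    D.toTheta x = 1 ↔ D.toTheta (ι x) = 1 := by
  rw [← ThetaCompanion.comm' ι c]
  exact (map_eq_one_iff c.thetaIso c.thetaIso.injective).symm

/-- `ι⁻¹(Π^tp_Ÿ) ⊆ Π^tp_Ÿ` (membership form of Thm 1.6 (i)). [cite: MochizukiEtTh2009, Thm 1.6 (i) p.24] -/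
theorem symm_mem_GtpYdd' (h : Thm16i ι) (x : D.PiTemp) (hx : x ∈ D.GtpYdd) : ι.symm x ∈ D.GtpYdd :=
  symm_mem_GtpYdd h ⟨x, hx⟩

/-- Membership in `Π^tp_Ÿ` is `ι`-invariant under Thm 1.6 (i). [cite: MochizukiEtTh2009, Thm 1.6 (i) p.24] -/
theorem mem_GtpYdd_iff_of_thm16i (h : Thm16i ι) (x : D.PiTemp) : x ∈ D.GtpYdd ↔ ι x ∈ D.GtpYdd := by
  refine ⟨fun hx => ?_, fun hx => ?_⟩
  · rw [← h]; exact ⟨x, hx, rfl⟩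
  · simpa using symm_mem_GtpYdd' ι h _ hx

/-- **abc-iut-L2-t1's `transport c h` (Thm 1.6 (iii): "the isomorphism of cohomology groups induced by
`γ`") IS abc-iut-L6-t1's `ContH1Aut.autMap` for the pair `(ι, γ^Θ)`** on `H¹(Π^tp_Ÿ, Δ_Θ)` — so the
hypothesis `hιη` below may be read in either vocabulary. [cite: MochizukiEtTh2009, Thm 1.6 (iii) p.24] -/
theorem transport_eq_autMap (c : ThetaCompanion ι) (h : Thm16i ι) (x : D.H1 D.GtpYdd) :
    transport c h x = ContH1Aut.autMap D.toTheta D.DeltaTheta ι c.thetaIso (ThetaCompanion.comm' ι c)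
      (ThetaCompanion.apply_mem' ι c) (symm_mem_GtpYdd' ι h) x := by
  induction x using QuotientGroup.induction_on with
  | H f => rfl

end InversionDatum

namespace EtaleThetaData.DoubleUnderline

variable {E : D.EtaleThetaData} {l : ℕ} (C : E.DoubleUnderline l) {N : ℕ+} (μ : D.CyclotomeMod l N)
  (ι : D.PiTemp ≃ₜ* D.PiTemp)

/-- `ι(Π^tp_X̲̲) = Π^tp_X̲̲` in membership form. [cite: MochizukiEtTh2009, Def 2.5 (i) p.39] -/
theorem mem_Huu_iff_of_map_eq (hι : C.Huu.map ι.toMulEquiv.toMonoidHom = C.Huu) (x : D.PiTemp) :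
    x ∈ C.Huu ↔ ι x ∈ C.Huu := by
  refine ⟨fun hx => ?_, fun hx => ?_⟩
  · rw [← hι]; exact ⟨x, hx, rfl⟩
  · have hx' : ι x ∈ C.Huu.map ι.toMulEquiv.toMonoidHom := by rw [hι]; exact hx
    obtain ⟨y, hy, hyx⟩ := hx'
    have : x = y := ι.injective (by rw [← hyx]; rfl)
    rw [this]; exact hy

/-- `ι⁻¹(Π^tp_Ÿ̲̲) ⊆ Π^tp_Ÿ̲̲` (`Π^tp_Ÿ̲̲ = Π^tp_Ÿ ∩ Π^tp_X̲̲`). [cite: MochizukiEtTh2009, Def 2.7 p.41] -/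
theorem symm_mem_GtpYdduu (h : Thm16i ι) (hι : C.Huu.map ι.toMulEquiv.toMonoidHom = C.Huu)
    (x : D.PiTemp) (hx : x ∈ C.GtpYdduu) : ι.symm x ∈ C.GtpYdduu := by
  refine Subgroup.mem_inf.2 ⟨symm_mem_GtpYdd' ι h x (Subgroup.mem_inf.1 hx).1, ?_⟩
  rw [C.mem_Huu_iff_of_map_eq ι hι, ContinuousMulEquiv.apply_symm_apply]
  exact (Subgroup.mem_inf.1 hx).2

/-- **The collection `η̲̈^{Θ,l·ℤ×μ₂}` is `ι`-stable**: if `ι` carries `η̈^Θ` to a `Π^tp_X̲̲`-conjugate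
(`hιη` — Prop 1.4 (ii) at the level of classes for the inversion), the transport `γ^Θ ∘ f ∘ ι⁻¹` of a root
cocycle (an `l·Δ_Θ`-valued lift of a `Π^tp_X̲̲`-conjugate of `η̈^Θ|_{Π^tp_Ÿ̲̲}`) is a root cocycle.
[cite: MochizukiEtTh2009, Def 2.7 p.41] -/
theorem autCocycle_mem_rootCocycles (c : ThetaCompanion ι) (h : Thm16i ι)
    (hι : C.Huu.map ι.toMulEquiv.toMonoidHom = C.Huu) (hC : D.Compat)
    (hιη : haveI := hC.GtpYdd_normal
      ∃ τ ∈ C.Huu, transport c h E.etaDd = ContH1.conj D.toTheta D.DeltaTheta τ E.etaDd)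
    (f : contCocycles D.toTheta D.DeltaTheta C.GtpYdduu) (hf : f ∈ C.rootCocycles hC) :
    ContH1Aut.autCocycle D.toTheta D.DeltaTheta ι c.thetaIso (ThetaCompanion.comm' ι c)
      (ThetaCompanion.apply_mem' ι c) (H := C.GtpYdduu) (H' := C.GtpYdduu)
      (C.symm_mem_GtpYdduu ι h hι) f ∈ C.rootCocycles hC := by
  haveI := hC.GtpYdd_normal
  refine ⟨fun g => ?_, ?_⟩
  · rw [ContH1Aut.coe_autCocycle_apply]
    exact (ThetaCompanion.mem_lDeltaTheta_iff ι c l _).1 (hf.1 _)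
  · obtain ⟨σ, hσ, hclass⟩ := hf.2
    obtain ⟨τ, hτ, hτeq⟩ := hιη
    refine ⟨ι σ * τ, C.Huu.mul_mem ((C.mem_Huu_iff_of_map_eq ι hι σ).1 hσ) hτ, ?_⟩
    have h1 : ContH1.mk
        (ContH1Aut.autCocycle D.toTheta D.DeltaTheta ι c.thetaIso (ThetaCompanion.comm' ι c)
          (ThetaCompanion.apply_mem' ι c) (H := C.GtpYdduu) (H' := C.GtpYdduu)
          (C.symm_mem_GtpYdduu ι h hι) f).1
        (ContH1Aut.autCocycle D.toTheta D.DeltaTheta ι c.thetaIso (ThetaCompanion.comm' ι c)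
          (ThetaCompanion.apply_mem' ι c) (H := C.GtpYdduu) (H' := C.GtpYdduu)
          (C.symm_mem_GtpYdduu ι h hι) f).2 =
        ContH1Aut.autMap D.toTheta D.DeltaTheta ι c.thetaIso (ThetaCompanion.comm' ι c)
          (ThetaCompanion.apply_mem' ι c) (C.symm_mem_GtpYdduu ι h hι) (ContH1.mk f.1 f.2) := rfl
    rw [h1, hclass, ← ContH1Aut.res_autMap D.toTheta D.DeltaTheta ι c.thetaIso
      (ThetaCompanion.comm' ι c) (ThetaCompanion.apply_mem' ι c) inf_le_left inf_le_left
      (C.symm_mem_GtpYdduu ι h hι) (symm_mem_GtpYdd' ι h),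
      ContH1Aut.autMap_conj, ← transport_eq_autMap ι c h, hτeq, ← ContH1.conj_mul_apply]

/-- A restriction `φ` of `ι` to `Π^tp_X̲̲` restricts `ι⁻¹` as well. [cite: MochizukiEtTh2009, Def 2.5 (i) p.39] -/
theorem coe_symm_of_coe_eq (φ : ↥C.Huu ≃ₜ* ↥C.Huu) (hφ : ∀ x : C.Huu, ((φ x : C.Huu) : D.PiTemp) = ι x)
    (x : C.Huu) : ((φ.symm x : C.Huu) : D.PiTemp) = ι.symm x := by
  have hx := hφ (φ.symm x)
  rw [ContinuousMulEquiv.apply_symm_apply] at hx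
  rw [hx, ContinuousMulEquiv.symm_apply_apply]

/-- `φ⁻¹(Π^tp_Ÿ̲̲) ⊆ Π^tp_Ÿ̲̲` inside `Π^tp_X̲̲`. [cite: MochizukiEtTh2009, Def 2.7 p.41] -/
theorem symm_mem_PiYdd (h : Thm16i ι) (φ : ↥C.Huu ≃ₜ* ↥C.Huu)
    (hφ : ∀ x : C.Huu, ((φ x : C.Huu) : D.PiTemp) = ι x) (d : D.GtpYdd.subgroupOf C.Huu) :
    φ.symm (d : C.Huu) ∈ D.GtpYdd.subgroupOf C.Huu := by
  rw [Subgroup.mem_subgroupOf, C.coe_symm_of_coe_eq ι φ hφ]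
  exact symm_mem_GtpYdd' ι h _ (Subgroup.mem_subgroupOf.1 d.2)

/-- A subgroup of `Π^tp_X̲̲` cut out by an `ι`-invariant condition is mapped onto itself by `φ`.
[cite: MochizukiEtTh2009, Cor 2.18 (i) p.60] -/
theorem map_eq_of_invariant (φ : ↥C.Huu ≃ₜ* ↥C.Huu) (hφ : ∀ x : C.Huu, ((φ x : C.Huu) : D.PiTemp) = ι x)
    (P : D.PiTemp → Prop) (hP : ∀ x, P x ↔ P (ι x)) (S : Subgroup C.Huu)
    (hS : ∀ x : C.Huu, x ∈ S ↔ P x) : S.map φ.toMulEquiv.toMonoidHom = S := by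
  ext x
  rw [Subgroup.mem_map]
  constructor
  · rintro ⟨y, hy, rfl⟩
    rw [hS] at hy ⊢
    change P ((φ y : C.Huu) : D.PiTemp)
    rw [hφ]
    exact (hP _).1 hy
  · intro hx
    refine ⟨φ.symm x, ?_, φ.apply_symm_apply x⟩
    rw [hS] at hx ⊢
    rw [C.coe_symm_of_coe_eq ι φ hφ, hP, ContinuousMulEquiv.apply_symm_apply]
    exact hx

/-- **The mod-`N` theta cocycles are stable under `η ↦ η ∘ ι⁻¹`** when `ι` acts by `+1` on `Δ_Θ`
(Prop 2.2 (i)) and carries `η̈^Θ` to a `Π^tp_X̲̲`-conjugate (Prop 1.4 (ii) at the level of classes): the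
hypothesis `hmem` of `Discharge/Sec2MonoThetaAutLift.lean` at abc-iut-L2-t8's `C.thetaEnvData`.
[cite: MochizukiEtTh2009, Prop 2.14(iii) p.50] -/
theorem comp_symm_mem_thetaCocycles (c : ThetaCompanion ι) (h : Thm16i ι)
    (hι : C.Huu.map ι.toMulEquiv.toMonoidHom = C.Huu) (φ : ↥C.Huu ≃ₜ* ↥C.Huu)
    (hφ : ∀ x : C.Huu, ((φ x : C.Huu) : D.PiTemp) = ι x) (hC : D.Compat)
    (hβ : ∀ a ∈ D.DeltaTheta, c.thetaIso a = a)
    (hιη : haveI := hC.GtpYdd_normal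
      ∃ τ ∈ C.Huu, transport c h E.etaDd = ContH1.conj D.toTheta D.DeltaTheta τ E.etaDd)
    {η : D.GtpYdd.subgroupOf C.Huu → MuN p N} (hη : η ∈ C.thetaCocycles hC μ) :
    (fun d : D.GtpYdd.subgroupOf C.Huu => η ⟨φ.symm (d : C.Huu), C.symm_mem_PiYdd ι h φ hφ d⟩) ∈
      C.thetaCocycles hC μ := by
  obtain ⟨f, hf, rfl⟩ := hη
  refine ⟨_, C.autCocycle_mem_rootCocycles ι c h hι hC hιη f hf, ?_⟩
  funext d
  change μ.red _ = μ.red _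
  congr 1
  apply Subtype.ext
  change ((f.1 (C.inclYdduu ⟨φ.symm (d : C.Huu), C.symm_mem_PiYdd ι h φ hφ d⟩) : D.DeltaTheta) : D.GtpTheta) = _
  rw [ContH1Aut.coe_autCocycle_apply, hβ _ (f.1 _).2]
  exact congrArg (fun a : C.GtpYdduu => ((f.1 a : D.DeltaTheta) : D.GtpTheta))
    (Subtype.ext (C.coe_symm_of_coe_eq ι φ hφ d))

/-- **[EtTh] Prop 2.14 (iii), `{±1}`-part, AT THE §1 MODEL (Cor 2.18 (ii) BY NAME).** For
`R = C.rigidData μ hC hS h15 L` and an inversion datum of §1 — an automorphism `ι` of `Π^tp_X` with theta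
companion `c` (Thm 1.6 (ii)), `ι(Π^tp_Ÿ) = Π^tp_Ÿ` (Thm 1.6 (i)), `ι(Π^tp_X̲̲) = Π^tp_X̲̲` (Def 2.5 (i)),
`ι(Π^tp_Y) = Π^tp_Y`, `ι(Δ^tp_X) = Δ^tp_X`, acting by `+1` on `Δ_Θ` (Prop 2.2 (i)) and carrying `η̈^Θ` to a
`Π^tp_X̲̲`-conjugate (Prop 1.4 (ii), class level) — and any restriction `φ` of `ι` to `Π^tp_X̲̲`: for every
theta cocycle `η`, SOME AUTOMORPHISM OF THE MODEL MONO-THETA ENVIRONMENT `M(η)` INDUCES `ι` ON `Π^tp_Y̲̲`.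
[cite: MochizukiEtTh2009, Prop 2.14(iii) p.50] -/
theorem rigidData_exists_monoIso_over_inversion (c : ThetaCompanion ι) (h : Thm16i ι)
    (hι : C.Huu.map ι.toMulEquiv.toMonoidHom = C.Huu) (φ : ↥C.Huu ≃ₜ* ↥C.Huu)
    (hφ : ∀ x : C.Huu, ((φ x : C.Huu) : D.PiTemp) = ι x) (hC : D.Compat) (hS : D.Sec2Hyps)
    (h15 : Prop15iii E hC) (L : C.CuspLabels) (h218ii : (C.rigidData μ hC hS h15 L).Cor218_ii)
    (hιY : ∀ x : D.PiTemp, x ∈ D.GtpY ↔ ι x ∈ D.GtpY)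
    (hιΔ : ∀ x : D.PiTemp, D.aug x = 1 ↔ D.aug (ι x) = 1)
    (hβ : ∀ a ∈ D.DeltaTheta, c.thetaIso a = a)
    (hιη : haveI := hC.GtpYdd_normal
      ∃ τ ∈ C.Huu, transport c h E.etaDd = ContH1.conj D.toTheta D.DeltaTheta τ E.etaDd)
    {η : D.GtpYdd.subgroupOf C.Huu → MuN p N} (hη : η ∈ C.thetaCocycles hC μ) :
    ∃ α : ((C.rigidData μ hC hS h15 L).modelMono hη).Iso ((C.rigidData μ hC hS h15 L).modelMono hη),
      ∀ x, (((CycEnvelope.proj (C.rigidData μ hC hS h15 L).augY (C.rigidData μ hC hS h15 L).chi (α.e x) :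
          (C.rigidData μ hC hS h15 L).PiY) : C.Huu) : D.PiTemp) =
        ι ((CycEnvelope.proj (C.rigidData μ hC hS h15 L).augY (C.rigidData μ hC hS h15 L).chi x :
          (C.rigidData μ hC hS h15 L).PiY) : C.Huu) := by
  -- the five Cor 2.18 (i) clauses for `φ`, from the `ι`-invariance of the defining conditions
  have hY' : (C.rigidData μ hC hS h15 L).PiY.map φ.toMulEquiv.toMonoidHom = (C.rigidData μ hC hS h15 L).PiY :=
    C.map_eq_of_invariant ι φ hφ (· ∈ D.GtpY) hιY _ fun x => Subgroup.mem_subgroupOf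
  have hdd' : (C.rigidData μ hC hS h15 L).PiYdd.map φ.toMulEquiv.toMonoidHom =
      (C.rigidData μ hC hS h15 L).PiYdd :=
    C.map_eq_of_invariant ι φ hφ (· ∈ D.GtpYdd) (mem_GtpYdd_iff_of_thm16i ι h) _
      fun x => Subgroup.mem_subgroupOf
  have hker' : (C.rigidData μ hC hS h15 L).aug.ker.map φ.toMulEquiv.toMonoidHom =
      (C.rigidData μ hC hS h15 L).aug.ker :=
    C.map_eq_of_invariant ι φ hφ (fun x => D.aug x = 1) hιΔ _ fun x => by
      rw [MonoidHom.mem_ker]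
      exact ⟨fun hx => congrArg Subtype.val hx, fun hx => Subtype.ext hx⟩
  have hK' : (C.rigidData μ hC hS h15 L).thetaKer.map φ.toMulEquiv.toMonoidHom =
      (C.rigidData μ hC hS h15 L).thetaKer :=
    C.map_eq_of_invariant ι φ hφ (fun x => D.toTheta x = 1) (ThetaCompanion.toTheta_eq_one_iff ι c) _
      fun x => by rw [MonoidHom.mem_ker]; rfl
  have hL' : (C.rigidData μ hC hS h15 L).lDeltaTheta.map φ.toMulEquiv.toMonoidHom =
      (C.rigidData μ hC hS h15 L).lDeltaTheta :=
    C.map_eq_of_invariant ι φ hφ (fun x => D.toTheta x ∈ D.lDeltaTheta l)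
      (fun x => by rw [ThetaCompanion.mem_lDeltaTheta_iff ι c, ThetaCompanion.comm' ι c]) _
      fun x => by rw [Subgroup.mem_comap]; rfl
  obtain ⟨α, hα⟩ := RigidData.exists_monoIso_over_aut_of_comp_symm_mem (C.rigidData μ hC hS h15 L)
    h218ii hη φ hY' hdd' hker' hK' hL' (C.comp_symm_mem_thetaCocycles μ ι c h hι φ hφ hC hβ hιη hη)
  exact ⟨α, fun x => by rw [← hφ, ← hα x]⟩

/-- **[EtTh] Prop 2.14 (iii), `{±1}`-part, AT THE §1 MODEL, every level of a `CyclotomeTower`**: as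
`rigidData_exists_monoIso_over_inversion`, with Cor 2.18 (ii) supplied by abc-iut-L2-t10's theorem
`rigidData_cor218_ii` — conditional on abc-iut-L2-t1's named facts Prop 1.5 (ii), (iii) and the
inversion datum only. [cite: MochizukiEtTh2009, Prop 2.14(iii) p.50] -/
theorem rigidData_exists_monoIso_over_inversion_tower {Es : Set ℕ+} (τ : D.CyclotomeTower l Es) (M : Es)
    (c : ThetaCompanion ι) (h : Thm16i ι) (hι : C.Huu.map ι.toMulEquiv.toMonoidHom = C.Huu)
    (φ : ↥C.Huu ≃ₜ* ↥C.Huu) (hφ : ∀ x : C.Huu, ((φ x : C.Huu) : D.PiTemp) = ι x)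
    (hC : D.Compat) (hS : D.Sec2Hyps)
    (h15 : Prop15iii E hC) (h15ii : Prop15ii E.toKummerData hC) (L : C.CuspLabels)
    (hιY : ∀ x : D.PiTemp, x ∈ D.GtpY ↔ ι x ∈ D.GtpY)
    (hιΔ : ∀ x : D.PiTemp, D.aug x = 1 ↔ D.aug (ι x) = 1)
    (hβ : ∀ a ∈ D.DeltaTheta, c.thetaIso a = a)
    (hιη : haveI := hC.GtpYdd_normal
      ∃ τ ∈ C.Huu, transport c h E.etaDd = ContH1.conj D.toTheta D.DeltaTheta τ E.etaDd)
    {η : D.GtpYdd.subgroupOf C.Huu → MuN p M} (hη : η ∈ C.thetaCocycles hC (τ.mod M)) :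
    ∃ α : ((C.rigidData (τ.mod M) hC hS h15 L).modelMono hη).Iso
        ((C.rigidData (τ.mod M) hC hS h15 L).modelMono hη),
      ∀ x, (((CycEnvelope.proj (C.rigidData (τ.mod M) hC hS h15 L).augY
            (C.rigidData (τ.mod M) hC hS h15 L).chi (α.e x) :
          (C.rigidData (τ.mod M) hC hS h15 L).PiY) : C.Huu) : D.PiTemp) =
        ι ((CycEnvelope.proj (C.rigidData (τ.mod M) hC hS h15 L).augY
            (C.rigidData (τ.mod M) hC hS h15 L).chi x :
          (C.rigidData (τ.mod M) hC hS h15 L).PiY) : C.Huu) :=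
  C.rigidData_exists_monoIso_over_inversion (τ.mod M) ι c h hι φ hφ hC hS h15 L
    (C.rigidData_cor218_ii τ M hC hS h15 h15ii L) hιY hιΔ hβ hιη hη

end EtaleThetaData.DoubleUnderline

end ThetaSetting

end Literature.AnabelianGeometry.EtaleTheta

end
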